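import Literature.AlgebraicGeometry.Hironaka2017.Lib.FrobeniusPBasisEssFiniteType
import Literature.AlgebraicGeometry.Resolution.RegularLocalRingsProofs
import Mathlib.RingTheory.Localization.AtPrime.Basic
import Mathlib.Algebra.CharP.Reduced
import HarnessLib

/-!
# Crux `Steer` (stmt-ResolutionOfSingularities-16345), line `switching_dichotomy`, §σ2.20 NORMALISED START:
# piece (N5) — the LOCAL–GLOBAL FROBENIUS CONGRUENCE `exists_global_of_local_frobenius_congruence`

OURS (campaign `res-hironaka`, rung L ★L-G4, slot W4.1, chain W4.1; seat `res-L0-w41-stub-4` g4; Theses-free, definition-free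
helper for res-L0-w41-plan-1's RULING 7 (N5) «the one new algebra input» of the NORMALISED START, consumed BY NAME by res-type-082's
(N4) `noSingularCarrier_along_run`; replaces the role of no printed item; NOT a statement of the manuscript under review
[claim: Hironaka2017, status: under-review]; AI-produced, which is weaker than expert review).

**Statement.** `R` a regular local ring of characteristic `p`, F-finite, with perfect residue field; `π ∈ R` a prime element;
`f ∈ R`. If `f` is a `p`-th power modulo `π ^ p` LOCALLY at `(π)` — i.e. `f − θ ^ p ∈ π ^ p • R_(π)` for some `θ ∈ R_(π)` — then it
is so GLOBALLY: `f − g ^ p ∈ π ^ p • R` for some `g ∈ R`.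

**Proof (RULING 7 (N5), made basis-explicit).** By Kunz (tree: `S02Preliminaries.exists_basis_frobeniusPower_monomials`) `R` is a
FREE module over its subring `ρ(R) = {r ^ p}` on the `x`-monomial basis `x ^ α` (`α_i < p`) of a regular system of parameters — a
basis containing `x ^ 0 = 1`. Clearing denominators (a localisation at `M ⊆ R ∖ (π)` inverts only `p`-th powers: `1/m = m^{p-1}/m^p`)
the local hypothesis reads `s ^ p · f = θ ^ p + π ^ p · a` with `s, θ, a ∈ R`, `π ∤ s`. Expanding `f = Σ c_α ^ p x ^ α`,
`a = Σ d_α ^ p x ^ α` and comparing `ρ(R)`-coordinates off the basis vector `1`: `(s c_α) ^ p = (π d_α) ^ p`, so `s c_α = π d_α`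
(Frobenius is injective on a reduced ring), so `π ∣ c_α` (`π` prime, `π ∤ s`); hence `f − c_0 ^ p = π ^ p · Σ_{α ≠ 0} (c_α/π) ^ p x ^ α`.
No regularity of `R ⧸ (π)` and no height hypothesis is used (in a regular local ring every height-one prime is `(π)` anyway).

Contents: `exists_pow_add_mul_of_basis` (pure algebra core: any reduced ring of characteristic `p` free over `ρ(R)` on a basis
containing `1`) · `exists_pow_add_mul_of_isRegularLocalRing` (denominator form) · `exists_pow_add_mul_of_isLocalization` (any
localisation at a submonoid missing `(π)`) · **`exists_global_of_local_frobenius_congruence`** (the (N5) shape: `IsLocalization.AtPrime`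
at `Ideal.span {π}`, ideal-membership form) · `exists_global_of_local_frobenius_congruence_dvd` (res-D-pv-012's localisation-free
divisibility spelling `π ∤ s`, `π ^ p ∣ s ^ p * f - a ^ p ⟹ ∃ g, π ^ p ∣ f - g ^ p`) · `…_of_essFiniteType` variants (regular local rings essentially of finite type over a
perfect field `𝕂` with residue field algebraic over `𝕂` — the setting of the members `R i` of the chain). [folklore; Kunz1969 Thm. 2.1
for the `p`-basis]
-/

-- `Summit.<S>.<S>.…` duplicates the summit name by design (single-problem summit).
set_option linter.dupNamespace false

open IsLocalRing
open Literature.AlgebraicGeometry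
open Literature.AlgebraicGeometry.Hironaka2017.S02Preliminaries

namespace Summit.ResolutionOfSingularities.ResolutionOfSingularities.Theorems.SwitchingDichotomy

namespace LocalGlobalFrobenius

universe u v w

section Core

variable {R : Type u} [CommRing R] {p : ℕ} [Fact p.Prime] [CharP R p]

/-- **Core (pure algebra).** `R` reduced of characteristic `p`, free over `ρ(R) = {r ^ p}` on a finite basis `b` with `b i₀ = 1`;
`π` prime, `π ∤ s`, `s ^ p * f = θ ^ p + π ^ p * a`. Then `f = g ^ p + π ^ p * c` for some `g c : R`. [folklore] -/
theorem exists_pow_add_mul_of_basis [IsReduced R] {ι : Type v} [Fintype ι]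
    (b : Module.Basis ι (frobeniusPowerSubring R p 1) R) {i₀ : ι} (hb : b i₀ = 1)
    {π : R} (hπ : Prime π) {f s θ a : R} (hs : ¬ π ∣ s) (h : s ^ p * f = θ ^ p + π ^ p * a) :
    ∃ g c : R, f = g ^ p + π ^ p * c := by
  classical
  have hmem : ∀ r : R, r ^ p ∈ frobeniusPowerSubring R p 1 := fun r =>
    mem_frobeniusPowerSubring_iff.mpr ⟨r, by rw [pow_one]⟩
  have hrepr1 : b.repr 1 = Finsupp.single i₀ 1 := by rw [← hb, b.repr_self]
  -- the coordinate equations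
  have key : ∀ α, (⟨s ^ p, hmem s⟩ : frobeniusPowerSubring R p 1) * b.repr f α =
      (⟨θ ^ p, hmem θ⟩ : frobeniusPowerSubring R p 1) * Finsupp.single i₀ (1 : frobeniusPowerSubring R p 1) α +
        (⟨π ^ p, hmem π⟩ : frobeniusPowerSubring R p 1) * b.repr a α := by
    intro α
    have e1 : (⟨s ^ p, hmem s⟩ : frobeniusPowerSubring R p 1) • f =
        (⟨θ ^ p, hmem θ⟩ : frobeniusPowerSubring R p 1) • (1 : R) +
          (⟨π ^ p, hmem π⟩ : frobeniusPowerSubring R p 1) • a := by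
      simp only [Subring.smul_def, smul_eq_mul, mul_one]
      exact h
    have e2 := congrArg (fun m => b.repr m α) e1
    simp only [map_smul, map_add, Finsupp.smul_apply, Finsupp.add_apply, smul_eq_mul, hrepr1] at e2
    exact e2
  -- off the basis vector `1` every coordinate of `f` is `π ^ p · (p-th power)`
  have hdiv : ∀ α, α ≠ i₀ → ∃ u : R, (b.repr f α : R) = π ^ p * u ^ p := by
    intro α hα
    have e := key α
    rw [Finsupp.single_apply, if_neg (Ne.symm hα), mul_zero, zero_add] at e
    obtain ⟨u, hu⟩ := mem_frobeniusPowerSubring_iff.mp (b.repr f α).2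
    obtain ⟨w, hw⟩ := mem_frobeniusPowerSubring_iff.mp (b.repr a α).2
    rw [pow_one] at hu hw
    have e' : (s * u) ^ p = (π * w) ^ p := by
      have e3 := congrArg Subtype.val e
      simp only [Subring.coe_mul] at e3
      rw [← hu, ← hw] at e3
      rw [mul_pow, mul_pow]
      exact e3
    have e'' : s * u = π * w := frobenius_inj R p (by rw [frobenius_def, frobenius_def]; exact e')
    have hπu : π ∣ u := (hπ.dvd_or_dvd ⟨w, e''⟩).resolve_left hs
    obtain ⟨u', rfl⟩ := hπu
    exact ⟨u', by rw [← hu, mul_pow]⟩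
  choose! u hu using hdiv
  obtain ⟨g, hg⟩ := mem_frobeniusPowerSubring_iff.mp (b.repr f i₀).2
  rw [pow_one] at hg
  refine ⟨g, ∑ α ∈ Finset.univ.erase i₀, u α ^ p * b α, ?_⟩
  calc f = ∑ α, (b.repr f α : R) * b α := by
        conv_lhs => rw [← b.sum_repr f]
        exact Finset.sum_congr rfl fun α _ => by rw [Subring.smul_def, smul_eq_mul]
    _ = (b.repr f i₀ : R) * b i₀ + ∑ α ∈ Finset.univ.erase i₀, (b.repr f α : R) * b α :=
        (Finset.add_sum_erase _ _ (Finset.mem_univ i₀)).symm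
    _ = g ^ p + π ^ p * ∑ α ∈ Finset.univ.erase i₀, u α ^ p * b α := by
        rw [← hg, hb, mul_one, Finset.mul_sum]
        congr 1
        exact Finset.sum_congr rfl fun α hα => by rw [hu α (Finset.ne_of_mem_erase hα), mul_assoc]

/-- Generators of the maximal ideal indexed by `Fin (spanFinrank 𝔪)` (Noetherian local ring). [folklore] -/
theorem exists_generators_maximalIdeal [IsLocalRing R] [IsNoetherianRing R] :
    ∃ x : Fin (maximalIdeal R).spanFinrank → R, Ideal.span (Set.range x) = maximalIdeal R := by
  classical
  obtain ⟨s, hcard, hspan⟩ :=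
    Submodule.FG.exists_span_finset_card_eq_spanFinrank (IsNoetherian.noetherian (maximalIdeal R))
  refine ⟨fun i => ((s.equivFinOfCardEq hcard).symm i : R), ?_⟩
  have hrange : Set.range (fun i => ((s.equivFinOfCardEq hcard).symm i : R)) = ↑s := by
    ext y
    constructor
    · rintro ⟨i, rfl⟩
      exact Finset.coe_mem _
    · intro hy
      exact ⟨s.equivFinOfCardEq hcard ⟨y, hy⟩, by simp⟩
  rw [hrange]
  exact hspan

/-- **Denominator form.** `R` regular local of characteristic `p`, F-finite (`IsFFinite p 1 R`), perfect residue field; `π` prime,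
`π ∤ s`, `s ^ p * f = θ ^ p + π ^ p * a` ⟹ `f = g ^ p + π ^ p * c`. (Kunz: `R` is free over `ρ(R)` on the `x`-monomials, `x ^ 0 = 1`.)
[folklore; cite: Kunz1969, Thm. 2.1 (the `p`-basis, tree `exists_basis_frobeniusPower_monomials`)] -/
theorem exists_pow_add_mul_of_isRegularLocalRing [IsRegularLocalRing R] [PerfectField (ResidueField R)]
    (hF : Resolution.IsFFinite p 1 R) {π : R} (hπ : Prime π) {f s θ a : R} (hs : ¬ π ∣ s)
    (h : s ^ p * f = θ ^ p + π ^ p * a) : ∃ g c : R, f = g ^ p + π ^ p * c := by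
  classical
  haveI := Resolution.isDomain_of_isRegularLocalRing R
  obtain ⟨x, hx⟩ := exists_generators_maximalIdeal (R := R)
  obtain ⟨b, hb⟩ := exists_basis_frobeniusPower_monomials (p := p) rfl x hx hF
  have hp1 : 0 < p ^ 1 := pow_pos (Fact.out : p.Prime).pos 1
  have hb0 : b (fun _ => ⟨0, hp1⟩) = 1 := by
    rw [hb]
    exact Finset.prod_eq_one fun i _ => by rw [pow_zero]
  exact exists_pow_add_mul_of_basis b hb0 hπ hs h

/-- **Localised form.** Same `R`; `M` a submonoid none of whose elements is divisible by `π`, `Rq` any localisation of `R` at `M`.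
If `f = θ ^ p + π ^ p * a` in `Rq` then `f = g ^ p + π ^ p * c` in `R`. (Clearing denominators costs only `p`-th powers:
multiply by `(c d) ^ p`.) [folklore] -/
theorem exists_pow_add_mul_of_isLocalization [IsRegularLocalRing R] [PerfectField (ResidueField R)]
    (hF : Resolution.IsFFinite p 1 R) {π : R} (hπ : Prime π) (M : Submonoid R) (hM : ∀ m ∈ M, ¬ π ∣ m)
    (Rq : Type w) [CommRing Rq] [Algebra R Rq] [IsLocalization M Rq] {f : R}
    (h : ∃ θ a : Rq, algebraMap R Rq f = θ ^ p + algebraMap R Rq π ^ p * a) :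
    ∃ g c : R, f = g ^ p + π ^ p * c := by
  obtain ⟨θ, a, h⟩ := h
  obtain ⟨θ₀, a₀, d, hθ, ha⟩ := IsLocalization.surj₂ M Rq θ a
  obtain ⟨p', hp'⟩ : ∃ p', p = p' + 1 := ⟨p - 1, (Nat.sub_add_cancel (Fact.out : p.Prime).one_lt.le).symm⟩
  have e1 : algebraMap R Rq ((d : R) ^ p * f) = algebraMap R Rq (θ₀ ^ p + π ^ p * (a₀ * (d : R) ^ p')) := by
    rw [map_mul, map_pow, h, map_add, map_mul, map_mul, map_pow, map_pow, map_pow, ← hθ, ← ha, hp']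
    ring
  obtain ⟨c, hc⟩ := (IsLocalization.eq_iff_exists M Rq).mp e1
  have e2 : ((c : R) * d) ^ p * f = ((c : R) * θ₀) ^ p + π ^ p * ((c : R) ^ p * a₀ * (d : R) ^ p') := by
    rw [hp'] at hc ⊢
    linear_combination (c : R) ^ p' * hc
  exact exists_pow_add_mul_of_isRegularLocalRing hF hπ (fun hdvd => hM _ (M.mul_mem c.2 d.2) hdvd) e2

/-- **(N5) LOCAL–GLOBAL FROBENIUS CONGRUENCE** (res-L0-w41-plan-1 RULING 7 (N5), shape of record). `R` regular local of
characteristic `p`, F-finite, perfect residue field; `π ∈ R` prime (so `q = (π)` is a height-one prime); `Rq` the localisation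
at `q`. If `f − θ ^ p ∈ π ^ p • Rq` for some `θ ∈ Rq`, then `f − g ^ p ∈ π ^ p • R` for some `g ∈ R`. [folklore] -/
theorem exists_global_of_local_frobenius_congruence [IsRegularLocalRing R] [PerfectField (ResidueField R)]
    (hF : Resolution.IsFFinite p 1 R) {π : R} (hπ : Prime π) [(Ideal.span {π}).IsPrime]
    (Rq : Type w) [CommRing Rq] [Algebra R Rq] [IsLocalization.AtPrime Rq (Ideal.span {π})] {f : R}
    (h : ∃ θ : Rq, algebraMap R Rq f - θ ^ p ∈ Ideal.span {algebraMap R Rq π ^ p}) :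
    ∃ g : R, f - g ^ p ∈ Ideal.span {π ^ p} := by
  obtain ⟨θ, hθ⟩ := h
  obtain ⟨a, ha⟩ := Ideal.mem_span_singleton'.mp hθ
  have h' : ∃ θ a : Rq, algebraMap R Rq f = θ ^ p + algebraMap R Rq π ^ p * a :=
    ⟨θ, a, by rw [mul_comm, ha, add_sub_cancel]⟩
  obtain ⟨g, c, hgc⟩ := exists_pow_add_mul_of_isLocalization hF hπ (Ideal.span {π}).primeCompl
    (fun m hm hdvd => hm (Ideal.mem_span_singleton.mpr hdvd)) Rq h'
  exact ⟨g, Ideal.mem_span_singleton'.mpr ⟨c, by rw [hgc, add_sub_cancel_left, mul_comm]⟩⟩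

/-- **(N5), divisibility form** (res-D-pv-012's localisation-free spelling 08:33:24Z, binders VERBATIM): `π ∤ s` and
`π ^ p ∣ s ^ p * f - a ^ p` («`f ≡ (a/s) ^ p (mod π ^ p)` in `R_(π)`») ⟹ `π ^ p ∣ f - g ^ p` for some `g ∈ R`. [folklore] -/
theorem exists_global_of_local_frobenius_congruence_dvd [IsRegularLocalRing R] [PerfectField (ResidueField R)]
    (hF : Resolution.IsFFinite p 1 R) {π : R} (hπ : Prime π) {f a s : R} (hs : ¬ π ∣ s)
    (h : π ^ p ∣ s ^ p * f - a ^ p) : ∃ g : R, π ^ p ∣ f - g ^ p := by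
  obtain ⟨r, hr⟩ := h
  obtain ⟨g, c, hgc⟩ := exists_pow_add_mul_of_isRegularLocalRing hF hπ hs (θ := a) (a := r)
    (by rw [← hr, add_sub_cancel])
  exact ⟨g, ⟨c, by rw [hgc, add_sub_cancel_left]⟩⟩

end Core

section EssFiniteType

variable {𝕂 : Type u} [Field 𝕂] {R : Type v} [CommRing R] [Algebra 𝕂 R] (p : ℕ) [Fact p.Prime] [CharP 𝕂 p]

/-- **Denominator form, geometric setting.** `𝕂` perfect of characteristic `p`; `R` regular local, essentially of finite type over
`𝕂`, residue field algebraic over `𝕂` (e.g. the local ring of a variety over `𝕂` at a closed point); `π` prime, `π ∤ s`,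
`s ^ p * f = θ ^ p + π ^ p * a` ⟹ `f = g ^ p + π ^ p * c`. [folklore; cite: Kunz1969, §1 (F-finiteness), Thm. 2.1] -/
theorem exists_pow_add_mul_of_essFiniteType [PerfectRing 𝕂 p] [IsRegularLocalRing R] [Algebra.EssFiniteType 𝕂 R]
    [Algebra.IsAlgebraic 𝕂 (ResidueField R)] {π : R} (hπ : Prime π) {f s θ a : R} (hs : ¬ π ∣ s)
    (h : s ^ p * f = θ ^ p + π ^ p * a) : ∃ g c : R, f = g ^ p + π ^ p * c := by
  haveI : CharP R p := charP_of_algebra_field 𝕂 p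
  haveI : PerfectField 𝕂 := PerfectRing.toPerfectField 𝕂 p
  haveI : PerfectField (ResidueField R) := Algebra.IsAlgebraic.perfectField 𝕂
  exact exists_pow_add_mul_of_isRegularLocalRing (isFFinite_of_essFiniteType (𝕂 := 𝕂) p 1) hπ hs h

/-- **Localised form, geometric setting** (`M` a submonoid missing `(π)`, `Rq` any localisation at `M`). [folklore] -/
theorem exists_pow_add_mul_of_isLocalization_of_essFiniteType [PerfectRing 𝕂 p] [IsRegularLocalRing R]
    [Algebra.EssFiniteType 𝕂 R] [Algebra.IsAlgebraic 𝕂 (ResidueField R)] {π : R} (hπ : Prime π) (M : Submonoid R)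
    (hM : ∀ m ∈ M, ¬ π ∣ m) (Rq : Type w) [CommRing Rq] [Algebra R Rq] [IsLocalization M Rq] {f : R}
    (h : ∃ θ a : Rq, algebraMap R Rq f = θ ^ p + algebraMap R Rq π ^ p * a) :
    ∃ g c : R, f = g ^ p + π ^ p * c := by
  haveI : CharP R p := charP_of_algebra_field 𝕂 p
  haveI : PerfectField 𝕂 := PerfectRing.toPerfectField 𝕂 p
  haveI : PerfectField (ResidueField R) := Algebra.IsAlgebraic.perfectField 𝕂
  exact exists_pow_add_mul_of_isLocalization (isFFinite_of_essFiniteType (𝕂 := 𝕂) p 1) hπ M hM Rq h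

/-- **(N5) in the geometric setting**: `𝕂` perfect of characteristic `p`; `R` regular local essentially of finite type over `𝕂`
with residue field algebraic over `𝕂`; `π` prime, `Rq` the localisation at `(π)`; `f − θ ^ p ∈ π ^ p • Rq` ⟹ `f − g ^ p ∈ π ^ p • R`.
[folklore] -/
theorem exists_global_of_local_frobenius_congruence_of_essFiniteType [PerfectRing 𝕂 p] [IsRegularLocalRing R]
    [Algebra.EssFiniteType 𝕂 R] [Algebra.IsAlgebraic 𝕂 (ResidueField R)] {π : R} (hπ : Prime π)
    [(Ideal.span {π}).IsPrime] (Rq : Type w) [CommRing Rq] [Algebra R Rq] [IsLocalization.AtPrime Rq (Ideal.span {π})]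
    {f : R} (h : ∃ θ : Rq, algebraMap R Rq f - θ ^ p ∈ Ideal.span {algebraMap R Rq π ^ p}) :
    ∃ g : R, f - g ^ p ∈ Ideal.span {π ^ p} := by
  haveI : CharP R p := charP_of_algebra_field 𝕂 p
  haveI : PerfectField 𝕂 := PerfectRing.toPerfectField 𝕂 p
  haveI : PerfectField (ResidueField R) := Algebra.IsAlgebraic.perfectField 𝕂
  exact exists_global_of_local_frobenius_congruence (isFFinite_of_essFiniteType (𝕂 := 𝕂) p 1) hπ Rq h

/-- **(N5), divisibility form, geometric setting.** [folklore] -/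
theorem exists_global_of_local_frobenius_congruence_dvd_of_essFiniteType [PerfectRing 𝕂 p] [IsRegularLocalRing R]
    [Algebra.EssFiniteType 𝕂 R] [Algebra.IsAlgebraic 𝕂 (ResidueField R)] {π : R} (hπ : Prime π) {f a s : R}
    (hs : ¬ π ∣ s) (h : π ^ p ∣ s ^ p * f - a ^ p) : ∃ g : R, π ^ p ∣ f - g ^ p := by
  haveI : CharP R p := charP_of_algebra_field 𝕂 p
  haveI : PerfectField 𝕂 := PerfectRing.toPerfectField 𝕂 p
  haveI : PerfectField (ResidueField R) := Algebra.IsAlgebraic.perfectField 𝕂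
  exact exists_global_of_local_frobenius_congruence_dvd (isFFinite_of_essFiniteType (𝕂 := 𝕂) p 1) hπ hs h

end EssFiniteType

end LocalGlobalFrobenius

end Summit.ResolutionOfSingularities.ResolutionOfSingularities.Theorems.SwitchingDichotomy
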